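import Summits.AtomisticToContinuum.Crystallization.Theorems.ChargedEnergyGapStackingClass
import HarnessLib

/-!
# ChargedEnergyGap · NODE 68 «CascadeLoad», part A (lens-3 g68): the pivot, the pieces, the class-cut load channel

Part A of two (400-line cap): §L1 pivot / load / stiffness and the identity, §L2 odd bond moments, §L3 the class-generic bound and the two pieces;
part B (`ChargedEnergyGapCascadeLoad`): §L4 the glue [SQ] and the sanity instances, §L5 the record cones.  The node as a whole:

Line `stmt-AtomisticToContinuum-14231` (`PricedLinkCensus.ChargedEnergyGap`).  Residual of record after NODE 66 «StackingClass» (critic row 1278,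
record cone `chargedEnergyGap_of_maxCoverLocalLedgerFH_record`): the two class-restricted localised seam transfer bounds
(H𝄪ᶠ) `LocalSeamTransferBoundFcc` and (H𝄪ʰ) `LocalSeamTransferBoundHcp` at the record dials
`(s, λ_lab, ℓ, μ₀, τ, λ, ϱ, b₀, r_S, C_T, ϱχ, Cχ) = (3/5, 1/3, 3, 1/100, 3/100, 1/2, 160, 2/5, 3, 1/(3·10⁶), 80, 10⁻⁵)` — both HEAVY, UNDECIDED, IDEA-NEEDED.

THE IDENTITY.  The localised model of the far account is LINEAR PLUS `λ` TIMES QUADRATIC in the bond field: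
`modelFarL = loadL + λ·stiffL` (`modelFarL_eq_loadL_add_stiffL`, PROVED), `loadL = Σ_{y ∈ motif∖X} χ·w·l_y(β)` (the LOAD of the weights on the
field: first variation), `stiffL = Σ χ·w·q_y(β)` (the weighted excised Lennard-Jones second variation).

THE PIVOT.  `springL = Σ_{y ∈ motif∖X} χ(y)·w(y)·Σ'_{z ∈ P∖X, 0 < d_yz ≤ r₁} ⟪ê_yz, β y z⟫²` — the weighted, excised NEAREST-NEIGHBOUR LONGITUDINAL
UNIT-SPRING ENERGY (the octet-truss energy of the field; record range `r₁ = 6/5` separates the first shell `≤ 1.18` from the second `≥ 1.23` on the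
Barlow window).  It is NON-NEGATIVE, LOCAL, FINITE-RANGE, has NO PRESTRESS, and is ROTATION-BLIND BOND BY BOND (`springSite_rotField`: a rotation
cocycle has no longitudinal component on any bond) — exactly like the load (`loadL_rotField`), and unlike a Dirichlet energy (a ONE-gauge Dirichlet
pivot `creditL ∘ gaugedField` would make the stability half FALSE uniformly: position-dependent rotations of thin weighted walls between large core
zones have unbounded weighted Korn constant, cf. `twoRotations_not_gauged`).

THE SPLIT (class-generic in the reference binder `cls ∈ {IsFccImage, IsHcpImage, IsBarlowImage}`; every piece carries the hypothesis block of
(H𝄪ᶜ) VERBATIM, so each is comparable to it binder for binder):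
* [LOAD-ᶜ](`t, A_T, Aχ, r₁`) `LoadBoundCls cls` — CONSISTENCY: `−(A_T·M_sh + Aχ·M_tr + A_H·N_pr) ≤ loadL(β) + t·springL(β)`.  Equivalently (over
  `t > 0` with `A ∝ 1/t`): the squared `springL`-dual norm of the ghost-force load of the weights `χ·w` is paid by the shell / transition / priced
  currencies.  The load sees ONLY longitudinal bond components; the ghost force of a site is `F = −½∇ω·T − ¼∇²ω:M₃ − (1/12)∇³ω⋮M₄ − …` with
  `T` = site virial (`= 0`, `IsSiteStressFree`), `M₃` = the rank-3 bond moment `ghostMoment3` — which VANISHES at an inversion centre (every site of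
  an fcc-class reference; `ghostMoment3_eq_zero_of_inversionCentre`, PROVED) and ALTERNATES IN SIGN between the two sublattices exchanged by a
  point reflection of the point set (hcp; `ghostMoment3_pointReflection`, PROVED): the `O(∇²ω)` load channel is ABSENT in the fcc class and
  OPTICAL (sublattice-alternating, answered by the finite-stiffness internal mode) in the hcp class — the class-specific load order that motivated
  the class cut of NODE 66, now a pair of theorems.  UNDECIDED → TRUE-leaning · INSTRUMENTABLE (a positive-definite LOCAL quadratic programme on the
  C11-29 / χCOST-56 geometries: `min_β [loadL + t·springL]`) · ATTACKABLE-M (summation by parts against `∇²ω`/`∇³ω`, moment tables as explicit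
  `ℤ³`-sums à la `siteVirial_barlow_eq_tsum`, octet-truss rigidity for the longitudinal control, tail loads from spring-invisible regions — core
  zones, far patterns — paid by the `t`-independent part of `A`).
* [COER-ᶜ](`μ, c_T, cχ, r₁`) `CoerciveStiffCls cls` — STABILITY: `μ·springL(β) − (c_T·M_sh + cχ·M_tr + c_H·N_pr) ≤ stiffL(β)`: the weighted
  excised LJ second variation dominates `μ` times the octet-truss energy up to currency losses (edge-of-support and hole effects).  No load, no
  `λ`, scale-free; the prestress / farther-neighbour DESTABILISING bonds (`V′/d < 0` on first-shell transverse components, `V″ < 0` beyond the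
  inflection `≈ 1.109`) must be dominated by first-shell longitudinal stiffness `V″(0.971) ≈ 10.7` through the cocycle structure (second-shell
  strains are combinations of first-shell ones), rotations costing nothing on either side (`stiffL_rotField_empty`, `springL_rotField`).
  UNDECIDED → TRUE-leaning for `μ` up to about `2` (nearest-neighbour longitudinal part of `q_y` is `(V″/4)·springSite ≈ 2.68·springSite`) ·
  INSTRUMENTABLE (generalised eigenproblem `min stiffL/springL` over periodic fields on the record references and on the weighted C11-29 geometry)
  · ATTACKABLE-M (bond-sign decomposition + local domination; NO Korn constant needed because the pivot is longitudinal).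
* [SQ] ★★ THE GLUE, PROVED (`localSeamTransferBoundCls_of_load_of_coercive`): for `λ ≥ 0`,
  `[LOAD-ᶜ](t := λμ, A_T, Aχ) ∧ [COER-ᶜ](μ, c_T, cχ) ⟹ (H𝄪ᶜ)(C_T := A_T + λ·c_T, Cχ := Aχ + λ·cχ)` — add `λ×`[COER] to [LOAD]; the pivot cancels.
  Young's inequality in disguise: `inf_β [L + λQ] ≥ inf_β [L + λμ·S] − λ·c ≥ −‖L‖²_{S*}/(4λμ) − λ·c`.

TAGS (doctrine).  (H𝄪ᶜ) ⟸ [LOAD-ᶜ] ∧ [COER-ᶜ]: a GENUINE SPLIT by the structure of the inequality (first variation / second variation), NOT by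
field components (the quad cross term that killed every component split, memo g66 §1, does not arise: `β` is never decomposed).  Each piece is
STRICTLY WEAKER than (H𝄪ᶜ) in the doctrine's sense — neither is known to imply it (LOAD has no control of the LJ quadratic form, COER none of the
load) — and NEITHER IS ITS ANALOGUE: LOAD's quadratic term is positive-definite, local and prestress-free (all of LJ's indefiniteness is quarantined
in COER), COER has no first variation (all of the ghost-force analysis is quarantined in LOAD).  DIFFICULTY DISTRIBUTED: consistency (class
symmetry, moment tables, negative norm) ↔ stability (prestress domination, weighted localisation).  COMPOSITION LOSS versus the harmonic optimum of
(H𝄪ᶜ): the factor `(stiffL/springL on the load-bearing modes)/(min stiffL/springL)` — the anisotropy of the LJ form relative to the octet truss,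
`≈ 1.2–1.6` expected against the census margin `C_T/(measured) = 3.33/1.56 ≈ 2.1` at `λ = 1/2` (C11-29): TIGHT — the census decides (ASKs LOAD-68 /
STAB-68); the record cone is PARAMETRIC in `(μ, A, c, r₁)` under the two budget identities, with ONE designate.

RECORD (R5).  `localSeamTransferBoundCls_record_of_load_of_coercive` (any class, any `μ`, budget inequalities `A_T + c_T/2 ≤ 1/(3·10⁶)`,
`Aχ + cχ/2 ≤ 10⁻⁵`); ★★ `chargedEnergyGap_of_maxCoverCascade_record` (8 record leaves · [LOAD-ᶠ] · [COER-ᶠ] · [LOAD-ʰ] · [COER-ʰ] · (N𝄪ᶠʰ) · P_G ⟹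
ChargedEnergyGap, parametric); ★ `chargedEnergyGap_of_maxCoverCascade_designate` at the DESIGNATE `μ = 3/2` (`t = 3/4`), `(A_T, Aχ) = (3/10⁷, 9/10⁶)`,
`(c_T, cχ) = (1/(15·10⁶), 1/(5·10⁵))`, `r₁ = 6/5` (`record_cascade_budget`).  Consistency: (H𝄪ᶜ) at `(C_T, Cχ)` gives [LOAD-ᶜ](`t, C_T, Cχ`) for
NO `t` and [COER-ᶜ] for no `μ > 0` — the pieces are not corollaries of the target; conversely the g67 cone is recovered from [SQ] by name.

SANITY (PROVED).  Rotation instances (the census's (F1)/(F2) tables, the refuter of `HarmStableWith`): at a site-stress-free reference, no excision,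
no seams, the conclusions of BOTH pieces hold for the rotation cocycle with every non-negative allowance and EVERY `t`, `μ`
(`load_conclusion_rotField`, `coercive_conclusion_rotField`) — the pivot does not re-arm the rotation alarm.  Non-vacuity: the common hypothesis
block is inhabited at the record dials (`hypothesisBlockFcc_record_inhabited`, tree).  Monotonicity: LOAD is monotone in `t, A_T, Aχ`; COER antitone
in `μ`, monotone in `c_T, cχ`; (H𝄪ᶜ) monotone in `C_T, Cχ`.

0 sorry · 0 native_decide · no private / instance / notation · standard axioms (audit file `check/AuditCL68.lean` over the tower A ++ B).
-/

noncomputable section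
open scoped Classical
open Literature.MathematicalPhysics.StatisticalMechanics Literature.Geometry.DiscreteGeometry
open Summit.AtomisticToContinuum.Crystallization.Theses.PricedLinkCensus
open Summit.AtomisticToContinuum.Crystallization.Theorems.ChargedEnergyGapNegative

namespace Summit.AtomisticToContinuum.Crystallization.Theorems.ChargedEnergyGapChartDial

/-! ## §L1 The pivot energy and the load / stiffness parts of the localised model -/

section Pivot

variable (β : E3 → E3 → E3) (P : PeriodicConfiguration 3) (X : Set E3) (r₁ : ℝ)

/-- The **NEAREST-NEIGHBOUR LONGITUDINAL SPRING SITE ENERGY** of range `r₁`: `Σ'_{z ∈ P ∖ X, z ≠ y, d_yz ≤ r₁} ⟪ê_yz, β y z⟫²` (unit springs on the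
non-excised bonds of length `≤ r₁`; longitudinal components only — rotation-blind bond by bond). -/
def springSite (y : E3) : ℝ :=
  ∑' z : {z : E3 // z ∈ P.points ∧ z ∉ X ∧ z ≠ y ∧ dist y z ≤ r₁}, inner ℝ ((dist y (z : E3))⁻¹ • ((z : E3) - y)) (β y (z : E3)) ^ 2

/-- The spring site energy is non-negative … -/
theorem springSite_nonneg (y : E3) : 0 ≤ springSite β P X r₁ y :=
  tsum_nonneg fun _ => sq_nonneg _

/-- … and BLIND TO ROTATIONS: a rotation cocycle has no longitudinal component on any bond (`inner_unit_rotField`). -/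
theorem springSite_rotField (r₀ v y : E3) : springSite (rotField r₀ v) P X r₁ y = 0 := by
  simp [springSite, inner_unit_rotField]

variable (ϱχ : ℝ) {m : ℕ} (D : Fin m → Set E3) (σ : Fin m → Bool)

/-- The **LOAD** of the weights `χ·w` on the field: `Σ_{y ∈ motif ∖ X} χ(y)·w(y)·l_y(β)` (the linear part of `modelFarL`). -/
def loadL (β : E3 → E3 → E3) (P : PeriodicConfiguration 3) (X : Set E3) (ϱ : ℝ) (C : Set E3) : ℝ :=
  ∑ y ∈ P.motif, if y ∈ X then 0 else localFactor ϱχ D σ y * (profileWeight ϱ C y * linSite β P X y)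

/-- The **WEIGHTED EXCISED SECOND VARIATION**: `Σ_{y ∈ motif ∖ X} χ(y)·w(y)·q_y(β)` (the quadratic part of `modelFarL`, without `λ`). -/
def stiffL (β : E3 → E3 → E3) (P : PeriodicConfiguration 3) (X : Set E3) (ϱ : ℝ) (C : Set E3) : ℝ :=
  ∑ y ∈ P.motif, if y ∈ X then 0 else localFactor ϱχ D σ y * (profileWeight ϱ C y * quadSite β P X y)

/-- The **PIVOT**: the weighted excised octet-truss energy `Σ_{y ∈ motif ∖ X} χ(y)·w(y)·springSite_y(β)` — weighted and excised exactly like the model. -/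
def springL (β : E3 → E3 → E3) (P : PeriodicConfiguration 3) (X : Set E3) (r₁ ϱ : ℝ) (C : Set E3) : ℝ :=
  ∑ y ∈ P.motif, if y ∈ X then 0 else localFactor ϱχ D σ y * (profileWeight ϱ C y * springSite β P X r₁ y)

variable {ϱχ D σ}

/-- ★ THE IDENTITY: the localised model is the load plus `λ` times the weighted second variation. -/
theorem modelFarL_eq_loadL_add_stiffL (lamQ ϱ : ℝ) (C : Set E3) :
    modelFarL ϱχ D σ β P X lamQ ϱ C = loadL ϱχ D σ β P X ϱ C + lamQ * stiffL ϱχ D σ β P X ϱ C := by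
  unfold modelFarL loadL stiffL
  rw [Finset.mul_sum, ← Finset.sum_add_distrib]
  refine Finset.sum_congr rfl fun y _ => ?_
  split_ifs <;> ring

/-- The pivot is non-negative. -/
theorem springL_nonneg (ϱ : ℝ) (C : Set E3) : 0 ≤ springL ϱχ D σ β P X r₁ ϱ C :=
  Finset.sum_nonneg fun y _ => by
    split_ifs
    · exact le_rfl
    · exact mul_nonneg (localFactor_nonneg _ _ _ _) (mul_nonneg (profileWeight_nonneg _ _ _) (springSite_nonneg _ _ _ _ _))

/-- The load of a rotation cocycle vanishes (every reference, every excision: `linSite_rotField`) … -/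
theorem loadL_rotField (ϱ : ℝ) (C : Set E3) (r₀ v : E3) : loadL ϱχ D σ (rotField r₀ v) P X ϱ C = 0 := by
  simp [loadL, linSite_rotField]

/-- … so does its pivot energy … -/
theorem springL_rotField (ϱ : ℝ) (C : Set E3) (r₀ v : E3) : springL ϱχ D σ (rotField r₀ v) P X r₁ ϱ C = 0 := by
  simp [springL, springSite_rotField]

/-- … and, at a SITE-stress-free reference WITHOUT excision, its weighted second variation (`quadSite_rotField_eq_zero`, sitewise). -/
theorem stiffL_rotField_empty {P : PeriodicConfiguration 3} (hS : IsSiteStressFree P) (ϱ : ℝ) (C : Set E3) (r₀ v : E3) :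
    stiffL ϱχ D σ (rotField r₀ v) P ∅ ϱ C = 0 :=
  Finset.sum_eq_zero fun y hy => by simp [quadSite_rotField_eq_zero hS hy]

end Pivot

/-! ## §L2 The class-cut rank-3 load channel: odd bond sums under point reflections (PROVED) -/

section OddMoments

variable {P : PeriodicConfiguration 3}

/-- ★ ODD BOND SUMS UNDER A POINT REFLECTION OF THE POINT SET.  If `p ↦ c − p` maps `P.points` into itself, then for every ODD summand `g` the
bond sum at the reflected site `c − y` is MINUS the bond sum at `y` (no summability needed: reindexing by the reflection, `tsum_neg`). -/
theorem tsum_bond_odd_pointReflection {c : E3} (hc : ∀ p : E3, p ∈ P.points → c - p ∈ P.points) {g : E3 → ℝ}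
    (hg : ∀ x, g (-x) = -g x) (y : E3) :
    ∑' z : {z : E3 // z ∈ P.points ∧ z ≠ c - y}, g ((z : E3) - (c - y)) =
      -∑' z : {z : E3 // z ∈ P.points ∧ z ≠ y}, g ((z : E3) - y) := by
  let e : {z : E3 // z ∈ P.points ∧ z ≠ y} ≃ {z : E3 // z ∈ P.points ∧ z ≠ c - y} :=
    { toFun := fun z => ⟨c - (z : E3), hc _ z.2.1, fun h => z.2.2 (by
          have : c - (z : E3) = c - y := h
          exact sub_right_injective this)⟩
      invFun := fun w => ⟨c - (w : E3), hc _ w.2.1, fun h => w.2.2 (by simpa only [sub_sub_cancel] using congrArg (fun q => c - q) h)⟩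
      left_inv := fun z => Subtype.ext (sub_sub_cancel c (z : E3))
      right_inv := fun w => Subtype.ext (sub_sub_cancel c (w : E3)) }
  rw [← e.tsum_eq, ← tsum_neg]
  refine tsum_congr fun z => ?_
  have h1 : ((e z : {z : E3 // z ∈ P.points ∧ z ≠ c - y}) : E3) = c - (z : E3) := rfl
  rw [h1, show c - (z : E3) - (c - y) = -((z : E3) - y) by abel, hg]

/-- ★ At an INVERSION CENTRE of the point set (`p ↦ 2y − p` preserves `P.points` — every site of a Bravais lattice, in particular of an fcc-class
reference) EVERY ODD BOND SUM VANISHES. -/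
theorem tsum_bond_odd_eq_zero_of_inversionCentre {y : E3} (hy : ∀ p : E3, p ∈ P.points → (2 : ℝ) • y - p ∈ P.points) {g : E3 → ℝ}
    (hg : ∀ x, g (-x) = -g x) :
    ∑' z : {z : E3 // z ∈ P.points ∧ z ≠ y}, g ((z : E3) - y) = 0 := by
  have h2 : (2 : ℝ) • y - y = y := by rw [two_smul, add_sub_cancel_right]
  let e : {z : E3 // z ∈ P.points ∧ z ≠ y} ≃ {z : E3 // z ∈ P.points ∧ z ≠ y} :=
    Function.Involutive.toPerm
      (fun z => ⟨(2 : ℝ) • y - (z : E3), hy _ z.2.1, fun h => z.2.2 (by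
          have : (2 : ℝ) • y - (z : E3) = (2 : ℝ) • y - y := by rw [h2]; exact h
          exact sub_right_injective this)⟩)
      (fun z => Subtype.ext (sub_sub_cancel _ _))
  have hS : ∑' z : {z : E3 // z ∈ P.points ∧ z ≠ y}, g ((z : E3) - y) =
      -∑' z : {z : E3 // z ∈ P.points ∧ z ≠ y}, g ((z : E3) - y) := by
    conv_lhs => rw [← e.tsum_eq]
    rw [← tsum_neg]
    refine tsum_congr fun z => ?_
    have h1 : ((e z : {z : E3 // z ∈ P.points ∧ z ≠ y}) : E3) = (2 : ℝ) • y - (z : E3) := rfl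
    rw [h1, show (2 : ℝ) • y - (z : E3) - y = -((z : E3) - y) by rw [two_smul]; abel, hg]
  linarith

/-- The **RANK-3 GHOST-FORCE MOMENT** of the reference at the site `y`: `M₃(y)[a, b, c] = Σ'_{z ∈ P, z ≠ y} (V′(d)/d)·⟪a, z − y⟫⟪b, z − y⟫⟪c, z − y⟫`
(`d = ‖z − y‖`) — the coefficient of `∇²ω` in the ghost force of a smooth weight `ω` at a force-free, site-stress-free site. -/
def ghostMoment3 (P : PeriodicConfiguration 3) (y a b c : E3) : ℝ :=
  ∑' z : {z : E3 // z ∈ P.points ∧ z ≠ y},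
    ljD1 ‖(z : E3) - y‖ / ‖(z : E3) - y‖ * (inner ℝ a ((z : E3) - y) * inner ℝ b ((z : E3) - y) * inner ℝ c ((z : E3) - y))

/-- The rank-3 moment summand is ODD in the bond vector. -/
theorem ghostMoment3_summand_odd (a b c x : E3) :
    ljD1 ‖-x‖ / ‖-x‖ * (inner ℝ a (-x) * inner ℝ b (-x) * inner ℝ c (-x)) =
      -(ljD1 ‖x‖ / ‖x‖ * (inner ℝ a x * inner ℝ b x * inner ℝ c x)) := by
  simp only [norm_neg, inner_neg_right]
  ring

/-- ★ fcc MECHANISM (the `O(∇²ω)` load channel is ABSENT): at an inversion centre of the point set the rank-3 ghost-force moment VANISHES. -/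
theorem ghostMoment3_eq_zero_of_inversionCentre {y : E3} (hy : ∀ p : E3, p ∈ P.points → (2 : ℝ) • y - p ∈ P.points) (a b c : E3) :
    ghostMoment3 P y a b c = 0 :=
  tsum_bond_odd_eq_zero_of_inversionCentre (g := fun x => ljD1 ‖x‖ / ‖x‖ * (inner ℝ a x * inner ℝ b x * inner ℝ c x)) hy
    (ghostMoment3_summand_odd a b c)

/-- ★ hcp MECHANISM (the `O(∇²ω)` load channel is OPTICAL): under a point reflection `p ↦ c₀ − p` of the point set (hcp: through the mid-point of two
adjacent-layer neighbours, exchanging the two sublattices) the rank-3 moment at the image site is MINUS that at the site. -/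
theorem ghostMoment3_pointReflection {c₀ : E3} (hc : ∀ p : E3, p ∈ P.points → c₀ - p ∈ P.points) (y a b c : E3) :
    ghostMoment3 P (c₀ - y) a b c = -ghostMoment3 P y a b c :=
  tsum_bond_odd_pointReflection (g := fun x => ljD1 ‖x‖ / ‖x‖ * (inner ℝ a x * inner ℝ b x * inner ℝ c x)) hc
    (ghostMoment3_summand_odd a b c) y

end OddMoments

/-! ## §L3 The class-generic transfer bound and the two pieces -/

section Pieces

variable (cls : Set E3 → Prop) (s lam ℓ μ₀ τ lamQ ϱ b₀ r_S C_T ϱχ Cχ r₁ : ℝ)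

/-- The localised seam transfer bound over the reference class `cls` — (H𝄪ᶠ) / (H𝄪ʰ) / (H𝄪ᴮ) VERBATIM with the class binder abstracted
(`localSeamTransferBoundCls_fcc_iff`, `…_hcp_iff`, `…_barlow_iff`: `Iff.rfl`). -/
def LocalSeamTransferBoundCls : Prop :=
  ∃ C_H : ℝ, 0 ≤ C_H ∧ ∀ (P : PeriodicConfiguration 3) (C X : Set E3) (β₀ : E3 → E3 → E3) (k : ℕ) (S : Fin k → CutPiece)
    (m : ℕ) (D : Fin m → Set E3) (σ : Fin m → Bool),
    IsSeparatedRef s P → IsLabelledRef lam ℓ P → cls P.points → IsForceFree P → IsSiteStressFree P → HarmStableModRot μ₀ P →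
    IsInvariantSet P C → IsInvariantSet P X → IsGlobalCocycle P β₀ → IsSeamSystem b₀ r_S P S →
    SmallStrain τ P X (volterraField P S β₀) → (∀ i, IsInvariantSet P (D i)) →
      -(C_T * shellMassL ϱχ D σ P X ϱ C) - Cχ * transMassL ϱχ D σ P X ϱ C - C_H * (pricedNearCountL ϱχ D σ P X ϱ C : ℝ) ≤
        modelFarL ϱχ D σ (volterraField P S β₀) P X lamQ ϱ C

/-- ★ piece [LOAD-ᶜ](`t, A_T, Aχ, r₁`) · **CONSISTENCY — THE LOAD IS DOMINATED BY `t` TIMES THE PIVOT PLUS CURRENCIES**: over the hypothesis block of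
(H𝄪ᶜ), `−(A_T·M_sh + Aχ·M_tr + A_H·N_pr) ≤ loadL(β) + t·springL(β)` for the Volterra field `β` of the data (dials `(s, λ_lab, ℓ, μ₀, τ, ϱ, b₀, r_S, ϱχ, r₁ ; t, A_T, Aχ)` — the block of
(H𝄪ᶜ) without `λ, C_T, Cχ`, then the spring range and the three piece dials).  UNDECIDED → TRUE-leaning at the designate · INSTRUMENTABLE · ATTACKABLE-M.  Why it might fail:
the `springL`-dual norm of the ghost-force load exceeding `4t·A_T` per shell site — composition loss (anisotropy of the LJ form against the octet
truss) eating the census margin `≈ 2.1` of C11-29 at `λ = 1/2`; loads from spring-invisible regions (core zones, far patterns) needing more than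
the `t`-independent share of `A`. -/
def LoadBoundCls (t A_T Aχ : ℝ) : Prop :=
  ∃ A_H : ℝ, 0 ≤ A_H ∧ ∀ (P : PeriodicConfiguration 3) (C X : Set E3) (β₀ : E3 → E3 → E3) (k : ℕ) (S : Fin k → CutPiece)
    (m : ℕ) (D : Fin m → Set E3) (σ : Fin m → Bool),
    IsSeparatedRef s P → IsLabelledRef lam ℓ P → cls P.points → IsForceFree P → IsSiteStressFree P → HarmStableModRot μ₀ P →
    IsInvariantSet P C → IsInvariantSet P X → IsGlobalCocycle P β₀ → IsSeamSystem b₀ r_S P S →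
    SmallStrain τ P X (volterraField P S β₀) → (∀ i, IsInvariantSet P (D i)) →
      -(A_T * shellMassL ϱχ D σ P X ϱ C) - Aχ * transMassL ϱχ D σ P X ϱ C - A_H * (pricedNearCountL ϱχ D σ P X ϱ C : ℝ) ≤
        loadL ϱχ D σ (volterraField P S β₀) P X ϱ C + t * springL ϱχ D σ (volterraField P S β₀) P X r₁ ϱ C

/-- ★ piece [COER-ᶜ](`μ, c_T, cχ, r₁`) · **STABILITY — WEIGHTED EXCISED COERCIVITY OVER THE PIVOT**: over the hypothesis block of (H𝄪ᶜ),
`μ·springL(β) − (c_T·M_sh + cχ·M_tr + c_H·N_pr) ≤ stiffL(β)` (dials `(s, λ_lab, ℓ, μ₀, τ, ϱ, b₀, r_S, ϱχ, r₁ ; μ, c_T, cχ)`).  No load, no `λ`.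
UNDECIDED → TRUE-leaning for `μ` up to about `2` · INSTRUMENTABLE · ATTACKABLE-M.  Why it might fail: a small-strain periodic field concentrating on
the destabilising bonds (first-shell transverse `V′/d ≈ −0.24`, second-shell longitudinal `V″ ≈ −0.40`) where the weight `χ·w` varies fastest relative
to itself (edges of its support), beyond what the currencies absorb at the designate `(c_T, cχ) = (1/(15·10⁶), 1/(5·10⁵))`. -/
def CoerciveStiffCls (μ c_T cχ : ℝ) : Prop :=
  ∃ c_H : ℝ, 0 ≤ c_H ∧ ∀ (P : PeriodicConfiguration 3) (C X : Set E3) (β₀ : E3 → E3 → E3) (k : ℕ) (S : Fin k → CutPiece)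
    (m : ℕ) (D : Fin m → Set E3) (σ : Fin m → Bool),
    IsSeparatedRef s P → IsLabelledRef lam ℓ P → cls P.points → IsForceFree P → IsSiteStressFree P → HarmStableModRot μ₀ P →
    IsInvariantSet P C → IsInvariantSet P X → IsGlobalCocycle P β₀ → IsSeamSystem b₀ r_S P S →
    SmallStrain τ P X (volterraField P S β₀) → (∀ i, IsInvariantSet P (D i)) →
      μ * springL ϱχ D σ (volterraField P S β₀) P X r₁ ϱ C - c_T * shellMassL ϱχ D σ P X ϱ C - cχ * transMassL ϱχ D σ P X ϱ C -
          c_H * (pricedNearCountL ϱχ D σ P X ϱ C : ℝ) ≤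
        stiffL ϱχ D σ (volterraField P S β₀) P X ϱ C

variable {cls s lam ℓ μ₀ τ lamQ ϱ b₀ r_S C_T ϱχ Cχ r₁}

/-- TYPE PIN: the class-generic bound at `IsFccImage` IS (H𝄪ᶠ) … -/
theorem localSeamTransferBoundCls_fcc_iff :
    LocalSeamTransferBoundCls IsFccImage s lam ℓ μ₀ τ lamQ ϱ b₀ r_S C_T ϱχ Cχ ↔ LocalSeamTransferBoundFcc s lam ℓ μ₀ τ lamQ ϱ b₀ r_S C_T ϱχ Cχ :=
  Iff.rfl

/-- … at `IsHcpImage` it IS (H𝄪ʰ) … -/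
theorem localSeamTransferBoundCls_hcp_iff :
    LocalSeamTransferBoundCls IsHcpImage s lam ℓ μ₀ τ lamQ ϱ b₀ r_S C_T ϱχ Cχ ↔ LocalSeamTransferBoundHcp s lam ℓ μ₀ τ lamQ ϱ b₀ r_S C_T ϱχ Cχ :=
  Iff.rfl

/-- … and at `IsBarlowImage` it IS (H𝄪ᴮ). -/
theorem localSeamTransferBoundCls_barlow_iff :
    LocalSeamTransferBoundCls IsBarlowImage s lam ℓ μ₀ τ lamQ ϱ b₀ r_S C_T ϱχ Cχ ↔ LocalSeamTransferBoundB s lam ℓ μ₀ τ lamQ ϱ b₀ r_S C_T ϱχ Cχ :=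
  Iff.rfl

/-- (H𝄪ᶜ) is monotone in both allowances. -/
theorem LocalSeamTransferBoundCls.mono {C_T' Cχ' : ℝ} (hT : C_T ≤ C_T') (hχ : Cχ ≤ Cχ')
    (h : LocalSeamTransferBoundCls cls s lam ℓ μ₀ τ lamQ ϱ b₀ r_S C_T ϱχ Cχ) :
    LocalSeamTransferBoundCls cls s lam ℓ μ₀ τ lamQ ϱ b₀ r_S C_T' ϱχ Cχ' := by
  obtain ⟨C_H, hH, h⟩ := h
  refine ⟨C_H, hH, fun P C X β₀ k S m D σ h1 h2 hb h3 h4 h5 h6 h7 h8 h9 h10 h11 =>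
    le_trans ?_ (h P C X β₀ k S m D σ h1 h2 hb h3 h4 h5 h6 h7 h8 h9 h10 h11)⟩
  have hM := shellMassL_nonneg (ϱχ := ϱχ) (D := D) (σ := σ) P X ϱ C
  have hT' := transMassL_nonneg (ϱχ := ϱχ) (D := D) (σ := σ) P X ϱ C
  nlinarith [mul_le_mul_of_nonneg_right hT hM, mul_le_mul_of_nonneg_right hχ hT']

/-- [LOAD-ᶜ] is monotone in the penalty `t` (the pivot is non-negative) and in both allowances. -/
theorem LoadBoundCls.mono {t t' A_T A_T' Aχ Aχ' : ℝ} (ht : t ≤ t') (hA : A_T ≤ A_T') (hχ : Aχ ≤ Aχ')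
    (h : LoadBoundCls cls s lam ℓ μ₀ τ ϱ b₀ r_S ϱχ r₁ t A_T Aχ) : LoadBoundCls cls s lam ℓ μ₀ τ ϱ b₀ r_S ϱχ r₁ t' A_T' Aχ' := by
  obtain ⟨A_H, hH, h⟩ := h
  refine ⟨A_H, hH, fun P C X β₀ k S m D σ h1 h2 hb h3 h4 h5 h6 h7 h8 h9 h10 h11 => ?_⟩
  have H := h P C X β₀ k S m D σ h1 h2 hb h3 h4 h5 h6 h7 h8 h9 h10 h11
  have hM := shellMassL_nonneg (ϱχ := ϱχ) (D := D) (σ := σ) P X ϱ C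
  have hT' := transMassL_nonneg (ϱχ := ϱχ) (D := D) (σ := σ) P X ϱ C
  have hS := springL_nonneg (volterraField P S β₀) P X r₁ (ϱχ := ϱχ) (D := D) (σ := σ) ϱ C
  nlinarith [mul_le_mul_of_nonneg_right hA hM, mul_le_mul_of_nonneg_right hχ hT', mul_le_mul_of_nonneg_right ht hS]

/-- [COER-ᶜ] is antitone in the modulus `μ` and monotone in both losses. -/
theorem CoerciveStiffCls.mono {μ μ' c_T c_T' cχ cχ' : ℝ} (hμ : μ' ≤ μ) (hc : c_T ≤ c_T') (hχ : cχ ≤ cχ')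
    (h : CoerciveStiffCls cls s lam ℓ μ₀ τ ϱ b₀ r_S ϱχ r₁ μ c_T cχ) : CoerciveStiffCls cls s lam ℓ μ₀ τ ϱ b₀ r_S ϱχ r₁ μ' c_T' cχ' := by
  obtain ⟨c_H, hH, h⟩ := h
  refine ⟨c_H, hH, fun P C X β₀ k S m D σ h1 h2 hb h3 h4 h5 h6 h7 h8 h9 h10 h11 => ?_⟩
  have H := h P C X β₀ k S m D σ h1 h2 hb h3 h4 h5 h6 h7 h8 h9 h10 h11
  have hM := shellMassL_nonneg (ϱχ := ϱχ) (D := D) (σ := σ) P X ϱ C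
  have hT' := transMassL_nonneg (ϱχ := ϱχ) (D := D) (σ := σ) P X ϱ C
  have hS := springL_nonneg (volterraField P S β₀) P X r₁ (ϱχ := ϱχ) (D := D) (σ := σ) ϱ C
  nlinarith [mul_le_mul_of_nonneg_right hc hM, mul_le_mul_of_nonneg_right hχ hT', mul_le_mul_of_nonneg_right hμ hS]

end Pieces

end Summit.AtomisticToContinuum.Crystallization.Theorems.ChargedEnergyGapChartDial
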